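import Mathlib
import Summits.PneNP.PneNP.Theorems.ConvexRankGatesConvexGateBlindExactLiftingTriangleLineCover
import Summits.PneNP.PneNP.Theorems.ConvexRankGatesConvexGateBlindExactLiftingTrianglePsiTwo

/-!
# PneNP / ConvexRankGates — `ConvexGateBlind`, line `xor-door-perfect-completeness`:
# LEMMA Ψ — a column function whose monochromatic share beats `1/2` by a margin is rare relative to its
# breadth (prover seat 0, session 21)

Helper toward crux item stmt-PneNP-10680 (`--supports`; open stub `stub_exactLifting`; triangle instance of record,
vocabulary `Col`, `Tri`, `IsMono` of `…ExactLiftingTriangleLineCover`).  Memo ANALYSIS11, Step 2, top level.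

For a non-negative `v` on the pointer cube `[t]³` with mass `|v| = Σ_w v(w) > 0` and peak `≤ kmax`, and a colouring
`x ∈ Col_t = ({0,1}^t)³`, the monochromatic mass is `v(Mono_x) = Σ_{w mono under x} v(w)`.  The theorems of this file:

* `share_card_le` (parametric Lemma Ψ): for `c, η, η' > 0`,
  `#{x : (1/2 + c)|v| ≤ v(Mono_x)} ≤ 8^t e^{−9c²/(8η)} + (2^t/η)·2·(4^t e^{−9(c/4)²/(8η')} + (4^t/η') e^{−2(c/16)² η'η|v|/kmax})`;
* `breadth_share_le` (registered sub-goal `breadth_share_bound`): multiplying by the breadth `|v|/kmax ≤ t³` and using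
  `z e^{−Az} ≤ 1/A`,  `(|v|/kmax) · #{x : (1/2 + c)|v| ≤ v(Mono_x)} ≤ 8^t (t³ e^{−9c²/(8η)} + 2t³ e^{−9(c/4)²/(8η')}/η + 256/(c²η²η'²))`.

Proof = peeling the third block (`peel_card_le` of `…TriangleHoeffding`): given the colourings of blocks 1, 2 the
monochromatic mass is `Σ_d (x³_d ? U¹_d : U⁰_d)` with `U^β_d` the mass of `v` on the β-coloured quarter of the plane
`{w₃ = d}`; planes of relative mass `≥ η` are HEAVY (at most `1/η` of them), and a heavy plane is exceptional only on
the two-block event of `…TrianglePsiTwo` (`twoD_card_le`).  Elementary counting over `{0,1}^t`; no definitions.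
-/

set_option linter.dupNamespace false -- `Summit.PneNP.PneNP.…`: summit = sub-problem (D-0017)

namespace Summit.PneNP.PneNP.Theorems.XorDoor.TriLine

open scoped BigOperators
open Finset Real

noncomputable section

variable {t : ℕ}

/-! ## §4 Three blocks: Lemma Ψ -/

/-- Counting over a triple product, first two coordinates first. -/
lemma card_filter_triple_eq {α β γ : Type*} [Fintype α] [Fintype β] [Fintype γ] (P : α × β × γ → Prop)
    [DecidablePred P] :
    (#(univ.filter P) : ℝ) = ∑ ab : α × β, (#(univ.filter fun g => P (ab.1, ab.2, g)) : ℝ) := by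
  rw [card_filter_prod_eq]
  push_cast
  rw [Fintype.sum_prod_type]
  refine sum_congr rfl fun a _ => ?_
  rw [card_filter_prod_eq]
  push_cast
  rfl

/-- Sums over the pointer cube, third coordinate outermost. -/
lemma sum_tri_eq (f : Tri t → ℝ) : ∑ w, f w = ∑ d, ∑ a, ∑ b, f (a, b, d) := by
  calc ∑ w, f w = ∑ a, ∑ b, ∑ d, f (a, b, d) := by
        rw [Fintype.sum_prod_type]; simp_rw [Fintype.sum_prod_type]
    _ = ∑ a, ∑ d, ∑ b, f (a, b, d) := sum_congr rfl fun a _ => sum_comm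
    _ = ∑ d, ∑ a, ∑ b, f (a, b, d) := sum_comm

/-- positivity of the peak from positivity of the mass -/
lemma kmax_pos_of_sum₃ {v : Tri t → ℝ} {kmax : ℝ} (hkmax : ∀ w, v w ≤ kmax) (hV : 0 < ∑ w, v w) : 0 < kmax := by
  have h1 : ∑ w, v w ≤ ∑ _w : Tri t, kmax := sum_le_sum fun w _ => hkmax w
  rw [sum_const, card_univ, nsmul_eq_mul] at h1
  exact pos_of_mul_pos_right (hV.trans_le h1) (Nat.cast_nonneg _)

/-- breadth is at most `t³`: `|v| ≤ t³ · kmax` -/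
lemma sum_le_cube_mul {v : Tri t → ℝ} {kmax : ℝ} (hkmax : ∀ w, v w ≤ kmax) : ∑ w, v w ≤ (t : ℝ) ^ 3 * kmax := by
  have h1 : ∑ w, v w ≤ ∑ _w : Tri t, kmax := sum_le_sum fun w _ => hkmax w
  rw [sum_const, card_univ, nsmul_eq_mul] at h1
  simpa [Fintype.card_prod, Fintype.card_fin, pow_succ, mul_assoc] using h1

/-- The monochromatic mass, plane by plane along block 3: given the colourings `x¹, x²` of blocks 1, 2 it is
`Σ_d (x³_d ? U¹_d : U⁰_d)` with `U^β_d` the mass on the `β`-coloured quarter of the plane `{w₃ = d}`. -/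
lemma monoMass_eq_sum_planes (v : Tri t → ℝ) (x1 x2 x3 : Fin t → Bool) :
    ∑ w ∈ univ.filter (fun w : Tri t => IsMono (x1, x2, x3) w.1 w.2.1 w.2.2), v w
      = ∑ d, (if x3 d then ∑ a, ∑ b, (if x1 a = true ∧ x2 b = true then v (a, b, d) else 0)
          else ∑ a, ∑ b, (if x1 a = false ∧ x2 b = false then v (a, b, d) else 0)) := by
  rw [sum_filter, sum_tri_eq]
  refine sum_congr rfl fun d _ => ?_
  cases h3 : x3 d
  · rw [if_neg Bool.false_ne_true]
    refine sum_congr rfl fun a _ => sum_congr rfl fun b _ => ?_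
    cases h1 : x1 a <;> cases h2 : x2 b <;> simp [IsMono, h1, h2, h3]
  · rw [if_pos rfl]
    refine sum_congr rfl fun a _ => sum_congr rfl fun b _ => ?_
    cases h1 : x1 a <;> cases h2 : x2 b <;> simp [IsMono, h1, h2, h3]

/-- **LEMMA Ψ (parametric).** For a non-negative `v` on `[t]³` with mass `|v| > 0` and peak `≤ kmax`, and
`c, η, η' > 0`:
`#{x : (1/2 + c)|v| ≤ v(Mono_x)} ≤ 8^t e^{−9c²/(8η)} + (2^t/η)·2·(4^t e^{−9(c/4)²/(8η')} + (2^t/η')·2^t e^{−2(c/16)² η'η|v|/kmax})`. -/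
theorem share_card_le (v : Tri t → ℝ) (hv : ∀ w, 0 ≤ v w) {kmax : ℝ} (hkmax : ∀ w, v w ≤ kmax)
    (hV : 0 < ∑ w, v w) {c η η' : ℝ} (hc : 0 < c) (hη : 0 < η) (hη' : 0 < η') :
    (#(univ.filter fun x : Col t =>
        (1 / 2 + c) * ∑ w, v w ≤ ∑ w ∈ univ.filter (fun w : Tri t => IsMono x w.1 w.2.1 w.2.2), v w) : ℝ)
      ≤ 8 ^ t * exp (-(9 * c ^ 2 / (8 * η)))
        + 2 ^ t * (1 / η) * (2 * (4 ^ t * exp (-(9 * (c / 4) ^ 2 / (8 * η')))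
          + 2 ^ t * (1 / η') * (2 ^ t * exp (-(2 * (c / 16) ^ 2 * (η' * (η * ∑ w, v w)) / kmax))))) := by
  have hkmax0 : 0 < kmax := kmax_pos_of_sum₃ hkmax hV
  set V : ℝ := ∑ w, v w with hVdef
  -- plane masses
  have hPsum : ∑ d, ∑ a, ∑ b, v (a, b, d) = V := (sum_tri_eq v).symm
  have hP0 : ∀ d, 0 ≤ ∑ a, ∑ b, v (a, b, d) := fun d => sum_nonneg fun a _ => sum_nonneg fun b _ => hv _
  -- quarter masses are below the plane mass
  have hU0 : ∀ (x1 x2 : Fin t → Bool) (β : Bool) d,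
      0 ≤ ∑ a, ∑ b, (if x1 a = β ∧ x2 b = β then v (a, b, d) else 0) :=
    fun x1 x2 β d => sum_nonneg fun a _ => sum_nonneg fun b _ => by split_ifs <;> [exact hv _; exact le_rfl]
  have hU01 : ∀ (x1 x2 : Fin t → Bool) d,
      ∑ a, ∑ b, (if x1 a = false ∧ x2 b = false then v (a, b, d) else 0)
        + ∑ a, ∑ b, (if x1 a = true ∧ x2 b = true then v (a, b, d) else 0) ≤ ∑ a, ∑ b, v (a, b, d) := by
    intro x1 x2 d
    rw [← sum_add_distrib]
    refine sum_le_sum fun a _ => ?_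
    rw [← sum_add_distrib]
    refine sum_le_sum fun b _ => ?_
    have := hv (a, b, d)
    cases x1 a <;> cases x2 b <;> simp [this]
  -- heavy planes, their exceptional (2D) events, bad pairs of colourings
  set H : Finset (Fin t) := univ.filter fun d => η * V ≤ ∑ a, ∑ b, v (a, b, d) with hHdef
  set E : Fin t → Bool → Finset ((Fin t → Bool) × (Fin t → Bool)) := fun d β =>
    univ.filter fun x12 => (1 / 2 + c / 4) * ∑ a, ∑ b, v (a, b, d)
      < ∑ a, ∑ b, (if x12.1 a = β ∧ x12.2 b = β then v (a, b, d) else 0) with hEdef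
  set Bad : Finset ((Fin t → Bool) × (Fin t → Bool)) := H.biUnion fun d => E d false ∪ E d true with hBaddef
  have hHcard : (#H : ℝ) ≤ 1 / η := card_heavy_le (fun d => ∑ a, ∑ b, v (a, b, d)) hP0 hPsum.le hη hV
  -- good pairs: peel along block 3
  have hgood : ∀ x12 : (Fin t → Bool) × (Fin t → Bool), x12 ∉ Bad →
      (#(univ.filter fun x3 : Fin t → Bool =>
          (1 / 2 + c) * V ≤ ∑ w ∈ univ.filter (fun w : Tri t => IsMono (x12.1, x12.2, x3) w.1 w.2.1 w.2.2), v w) : ℝ)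
        ≤ 2 ^ t * exp (-(9 * c ^ 2 / (8 * η))) := by
    intro x12 hx12
    have hPEEL := peel_card_le (t := t)
      (fun d => (∑ a, ∑ b, (if x12.1 a = false ∧ x12.2 b = false then v (a, b, d) else 0)) / V)
      (fun d => (∑ a, ∑ b, (if x12.1 a = true ∧ x12.2 b = true then v (a, b, d) else 0)) / V)
      (fun d => (∑ a, ∑ b, v (a, b, d)) / V)
      (fun d => div_nonneg (hU0 _ _ _ _) hV.le)
      (fun d => div_nonneg (hU0 _ _ _ _) hV.le)
      (fun d => by
        show _ / V + _ / V ≤ _ / V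
        rw [← add_div]
        exact div_le_div_of_nonneg_right (hU01 _ _ _) hV.le)
      (by
        show ∑ d, (∑ a, ∑ b, v (a, b, d)) / V ≤ 1
        rw [← sum_div, hPsum, div_self hV.ne'])
      hc hη
      (fun d hd => by
        -- a heavy plane of a good pair is not exceptional
        have hd' : η * V ≤ ∑ a, ∑ b, v (a, b, d) := by
          have := hd; rwa [le_div_iff₀ hV] at this
        have hdH : d ∈ H := by rw [hHdef, mem_filter]; exact ⟨mem_univ _, hd'⟩
        have hnot : ∀ β, x12 ∉ E d β := fun β hx => hx12 (by
          rw [hBaddef, mem_biUnion]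
          refine ⟨d, hdH, ?_⟩
          cases β
          · exact mem_union_left _ hx
          · exact mem_union_right _ hx)
        have hle : ∀ β, ∑ a, ∑ b, (if x12.1 a = β ∧ x12.2 b = β then v (a, b, d) else 0)
            ≤ (1 / 2 + c / 4) * ∑ a, ∑ b, v (a, b, d) := by
          intro β
          have : ¬ ((1 / 2 + c / 4) * ∑ a, ∑ b, v (a, b, d)
              < ∑ a, ∑ b, (if x12.1 a = β ∧ x12.2 b = β then v (a, b, d) else 0)) := fun hlt =>
            hnot β (by rw [hEdef]; exact mem_filter.2 ⟨mem_univ _, hlt⟩)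
          exact not_lt.1 this
        show max (_ / V) (_ / V) ≤ (1 / 2 + c / 4) * (_ / V)
        rw [mul_div_assoc']
        exact max_le (div_le_div_of_nonneg_right (hle false) hV.le) (div_le_div_of_nonneg_right (hle true) hV.le))
    refine le_trans ?_ hPEEL
    refine Nat.cast_le.2 (card_le_card fun x3 hx3 => ?_)
    rw [mem_filter] at hx3 ⊢
    refine ⟨mem_univ _, ?_⟩
    have h := hx3.2
    rw [monoMass_eq_sum_planes] at h
    have hW : ∑ d, (if x3 d then (∑ a, ∑ b, (if x12.1 a = true ∧ x12.2 b = true then v (a, b, d) else 0)) / V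
          else (∑ a, ∑ b, (if x12.1 a = false ∧ x12.2 b = false then v (a, b, d) else 0)) / V)
        = (∑ d, (if x3 d then ∑ a, ∑ b, (if x12.1 a = true ∧ x12.2 b = true then v (a, b, d) else 0)
            else ∑ a, ∑ b, (if x12.1 a = false ∧ x12.2 b = false then v (a, b, d) else 0))) / V := by
      rw [sum_div]
      refine sum_congr rfl fun d _ => ?_
      split_ifs <;> rfl
    show 1 / 2 + c ≤ ∑ d, (if x3 d then (∑ a, ∑ b, (if x12.1 a = true ∧ x12.2 b = true then v (a, b, d) else 0)) / V
          else (∑ a, ∑ b, (if x12.1 a = false ∧ x12.2 b = false then v (a, b, d) else 0)) / V)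
    rw [hW, le_div_iff₀ hV]
    exact h
  -- bad pairs: few heavy planes, each rarely exceptional (2D)
  set e3 : ℝ := 2 * (4 ^ t * exp (-(9 * (c / 4) ^ 2 / (8 * η')))
      + 2 ^ t * (1 / η') * (2 ^ t * exp (-(2 * (c / 16) ^ 2 * (η' * (η * V)) / kmax)))) with he3def
  have he3 : 0 ≤ e3 := by positivity
  have hBad : (#Bad : ℝ) ≤ (1 / η) * e3 := by
    have h1 : (#Bad : ℝ) ≤ ∑ d ∈ H, (#(E d false ∪ E d true) : ℝ) := by
      rw [hBaddef]; exact_mod_cast card_biUnion_le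
    have h2 : ∀ d ∈ H, (#(E d false ∪ E d true) : ℝ) ≤ e3 := by
      intro d hd
      have hPd : η * V ≤ ∑ a, ∑ b, v (a, b, d) := (mem_filter.1 hd).2
      have hPpos : 0 < ∑ a, ∑ b, v (a, b, d) := lt_of_lt_of_le (by positivity) hPd
      have h2D : ∀ β, (#(E d β) : ℝ) ≤ 4 ^ t * exp (-(9 * (c / 4) ^ 2 / (8 * η')))
          + 2 ^ t * (1 / η') * (2 ^ t * exp (-(2 * (c / 16) ^ 2 * (η' * (η * V)) / kmax))) := by
        intro β
        have h := twoD_card_le (fun a b => v (a, b, d)) (fun a b => hv _) (fun a b => hkmax _) hPpos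
          (by positivity : 0 < c / 4) hη' β
        refine le_trans (le_of_eq (by rw [hEdef])) (h.trans ?_)
        have hc16 : c / 4 / 4 = c / 16 := by ring
        rw [hc16]
        apply add_le_add_right
        apply mul_le_mul_of_nonneg_left _ (by positivity)
        apply mul_le_mul_of_nonneg_left _ (by positivity)
        rw [exp_le_exp, neg_le_neg_iff]
        refine div_le_div_of_nonneg_right ?_ hkmax0.le
        exact mul_le_mul_of_nonneg_left (mul_le_mul_of_nonneg_left hPd hη'.le) (by positivity)
      calc (#(E d false ∪ E d true) : ℝ) ≤ #(E d false) + #(E d true) := by exact_mod_cast card_union_le _ _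
        _ ≤ e3 := by rw [he3def]; linarith [h2D false, h2D true]
    calc (#Bad : ℝ) ≤ ∑ d ∈ H, (#(E d false ∪ E d true) : ℝ) := h1
      _ ≤ ∑ d ∈ H, e3 := sum_le_sum h2
      _ = #H * e3 := by rw [sum_const, nsmul_eq_mul]
      _ ≤ (1 / η) * e3 := mul_le_mul_of_nonneg_right hHcard he3
  -- count over the pairs first, then split into good and bad
  rw [card_filter_triple_eq]
  have hsplit := sum_card_le_split
    (fun (x12 : (Fin t → Bool) × (Fin t → Bool)) (x3 : Fin t → Bool) =>
      (1 / 2 + c) * V ≤ ∑ w ∈ univ.filter (fun w : Tri t => IsMono (x12.1, x12.2, x3) w.1 w.2.1 w.2.2), v w)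
    Bad (by positivity) hgood
  simp only [Fintype.card_prod, Fintype.card_fun, Fintype.card_bool, Fintype.card_fin, Nat.cast_pow,
    Nat.cast_mul, Nat.cast_ofNat] at hsplit
  have h8 : (8 : ℝ) ^ t = 2 ^ t * 2 ^ t * 2 ^ t := by rw [← mul_pow, ← mul_pow]; norm_num
  calc (∑ x12 : (Fin t → Bool) × (Fin t → Bool), (#(univ.filter fun x3 : Fin t → Bool =>
          (1 / 2 + c) * V ≤ ∑ w ∈ univ.filter (fun w : Tri t => IsMono (x12.1, x12.2, x3) w.1 w.2.1 w.2.2), v w) : ℝ))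
      ≤ 2 ^ t * 2 ^ t * (2 ^ t * exp (-(9 * c ^ 2 / (8 * η)))) + 2 ^ t * #Bad := hsplit
    _ ≤ 8 ^ t * exp (-(9 * c ^ 2 / (8 * η))) + 2 ^ t * (1 / η) * e3 := by
        rw [h8, mul_assoc (2 ^ t * 2 ^ t : ℝ), mul_assoc (2 ^ t : ℝ) (1 / η)]
        gcongr

/-- **LEMMA Ψ, breadth form.** With the breadth `|v|/kmax ≤ t³` and `z e^{−Az} ≤ 1/A`:
`(|v|/kmax)·#{x : (1/2 + c)|v| ≤ v(Mono_x)} ≤ 8^t (t³ e^{−9c²/(8η)} + 2t³ e^{−9(c/4)²/(8η')}/η + 256/(c²η²η'²))`. -/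
theorem breadth_share_le (v : Tri t → ℝ) (hv : ∀ w, 0 ≤ v w) {kmax : ℝ} (hkmax : ∀ w, v w ≤ kmax)
    (hV : 0 < ∑ w, v w) {c η η' : ℝ} (hc : 0 < c) (hη : 0 < η) (hη' : 0 < η') :
    (∑ w, v w) / kmax * #(univ.filter fun x : Col t =>
        (1 / 2 + c) * ∑ w, v w ≤ ∑ w ∈ univ.filter (fun w : Tri t => IsMono x w.1 w.2.1 w.2.2), v w)
      ≤ 8 ^ t * ((t : ℝ) ^ 3 * exp (-(9 * c ^ 2 / (8 * η)))
          + 2 * t ^ 3 * exp (-(9 * (c / 4) ^ 2 / (8 * η'))) / η + 256 / (c ^ 2 * η ^ 2 * η' ^ 2)) := by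
  have hkmax0 : 0 < kmax := kmax_pos_of_sum₃ hkmax hV
  set V : ℝ := ∑ w, v w with hVdef
  have hbr0 : 0 ≤ V / kmax := div_nonneg hV.le hkmax0.le
  have hbr : V / kmax ≤ (t : ℝ) ^ 3 := by rw [div_le_iff₀ hkmax0]; exact sum_le_cube_mul hkmax
  have hN := share_card_le v hv hkmax hV hc hη hη'
  have hN0 : (0 : ℝ) ≤ #(univ.filter fun x : Col t =>
      (1 / 2 + c) * V ≤ ∑ w ∈ univ.filter (fun w : Tri t => IsMono x w.1 w.2.1 w.2.2), v w) := Nat.cast_nonneg _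
  -- the exponential term against the breadth
  have hz : V / kmax * exp (-(2 * (c / 16) ^ 2 * (η' * (η * V)) / kmax)) ≤ 1 / (2 * (c / 16) ^ 2 * η' * η) := by
    have hA : 0 < 2 * (c / 16) ^ 2 * η' * η := by positivity
    have := mul_exp_neg_le hA (V / kmax)
    rwa [show 2 * (c / 16) ^ 2 * η' * η * (V / kmax) = 2 * (c / 16) ^ 2 * (η' * (η * V)) / kmax by ring] at this
  calc V / kmax * #(univ.filter fun x : Col t =>
          (1 / 2 + c) * V ≤ ∑ w ∈ univ.filter (fun w : Tri t => IsMono x w.1 w.2.1 w.2.2), v w)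
      ≤ V / kmax * (8 ^ t * exp (-(9 * c ^ 2 / (8 * η)))
          + 2 ^ t * (1 / η) * (2 * (4 ^ t * exp (-(9 * (c / 4) ^ 2 / (8 * η')))
            + 2 ^ t * (1 / η') * (2 ^ t * exp (-(2 * (c / 16) ^ 2 * (η' * (η * V)) / kmax)))))) :=
        mul_le_mul_of_nonneg_left hN hbr0
    _ = (V / kmax) * (8 ^ t * exp (-(9 * c ^ 2 / (8 * η))))
        + (V / kmax) * (2 ^ t * (1 / η) * 2 * (4 ^ t * exp (-(9 * (c / 4) ^ 2 / (8 * η')))))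
        + 2 ^ t * (1 / η) * 2 * (2 ^ t * (1 / η') * 2 ^ t)
          * ((V / kmax) * exp (-(2 * (c / 16) ^ 2 * (η' * (η * V)) / kmax))) := by ring
    _ ≤ (t : ℝ) ^ 3 * (8 ^ t * exp (-(9 * c ^ 2 / (8 * η))))
        + (t : ℝ) ^ 3 * (2 ^ t * (1 / η) * 2 * (4 ^ t * exp (-(9 * (c / 4) ^ 2 / (8 * η')))))
        + 2 ^ t * (1 / η) * 2 * (2 ^ t * (1 / η') * 2 ^ t) * (1 / (2 * (c / 16) ^ 2 * η' * η)) := by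
        gcongr
    _ = 8 ^ t * ((t : ℝ) ^ 3 * exp (-(9 * c ^ 2 / (8 * η)))
          + 2 * t ^ 3 * exp (-(9 * (c / 4) ^ 2 / (8 * η'))) / η + 256 / (c ^ 2 * η ^ 2 * η' ^ 2)) := by
        have h4 : (4 : ℝ) ^ t = 2 ^ t * 2 ^ t := by rw [← mul_pow]; norm_num
        have h8' : (8 : ℝ) ^ t = 2 ^ t * 2 ^ t * 2 ^ t := by rw [← mul_pow, ← mul_pow]; norm_num
        rw [h4, h8']
        field_simp
        ring


/-- **LEMMA Ψ of ANALYSIS11, breadth form** (registered sub-goal `breadth_share_bound` of stmt-PneNP-10680, explicit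
vocabulary): for every non-negative `v` on the pointer cube with positive mass and peak `≤ kmax`, and `c, η, η' > 0`,
`(|v|/kmax)·#{x : (1/2 + c)|v| ≤ v(Mono_x)} ≤ 8^t (t³ e^{−9c²/(8η)} + 2t³ e^{−9(c/4)²/(8η')}/η + 256/(c²η²η'²))`. -/
theorem breadth_share_bound :
    ∀ (t : ℕ) (v : Fin t × Fin t × Fin t → ℝ), (∀ w, 0 ≤ v w) → ∀ (kmax : ℝ), (∀ w, v w ≤ kmax) →
    0 < ∑ w, v w → ∀ (c η η' : ℝ), 0 < c → 0 < η → 0 < η' →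
    (∑ w, v w) / kmax * ((Finset.univ.filter fun x : (Fin t → Bool) × (Fin t → Bool) × (Fin t → Bool) =>
        (1 / 2 + c) * ∑ w, v w ≤
          ∑ w ∈ (Finset.univ.filter fun w : Fin t × Fin t × Fin t => x.1 w.1 = x.2.1 w.2.1 ∧ x.1 w.1 = x.2.2 w.2.2),
            v w).card : ℝ)
      ≤ 8 ^ t * ((t : ℝ) ^ 3 * Real.exp (-(9 * c ^ 2 / (8 * η)))
          + 2 * t ^ 3 * Real.exp (-(9 * (c / 4) ^ 2 / (8 * η'))) / η + 256 / (c ^ 2 * η ^ 2 * η' ^ 2)) :=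
  fun _ v hv _ hkmax hV _ _ _ hc hη hη' => breadth_share_le v hv hkmax hV hc hη hη'

end

end Summit.PneNP.PneNP.Theorems.XorDoor.TriLine
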